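import Mathlib
import Mathlib.MeasureTheory.Function.LpSeminorm.Basic
import Mathlib.MeasureTheory.Function.LocallyIntegrable
import Literature.Analysis.FluidPDE.SelfSimilar
import Literature.Analysis.FluidPDE.MildSolution
import Literature.Analysis.FluidPDE.SuitableWeak
import Literature.Analysis.FluidPDE.AxisymmetricEuler
import Literature.Analysis.FluidPDE.NSWave0
import HarnessLib.Audit
import HarnessLib

/-!
# AxisymmetricSwirlRegularity — CONJECTURE (obligation of NavierStokesRegularity/NavierStokesRegularity)

Unproven conjecture migrated by the gate from `Literature/Analysis/FluidPDE/SelfSimilarLiouville.lean` (`Literature.Analysis.FluidPDE.AxisymmetricSwirlRegularity`): unproven conjectures are obligations of our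
theories, not literature facts (human ruling 2026-08-15). Provenance: see docstring. Routes use it as a crux item or via
`--conditional-bridge --conditional-on AxisymmetricSwirlRegularity`; a proof goes in the sibling `Theorems/AxisymmetricSwirlRegularityHolds.lean` as `theorem AxisymmetricSwirlRegularity_holds : AxisymmetricSwirlRegularity` so this file stays a conjecture LEAF that Literature/ may import.
-/

namespace Summit.NavierStokesRegularity.NavierStokesRegularity

open Literature Literature.Analysis Literature.Analysis.FluidPDE
open MeasureTheory Set Function Filter Topology TopologicalSpace
open scoped ContDiff NNReal ENNReal InnerProductSpace RealInnerProductSpace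
local notation "ℝ³" => EuclideanSpace ℝ (Fin 3)

/-- **ns.S25** (AX) (global regularity for axisymmetric data *with swirl*, wall
`summits/ns-w-axisym-swirl/SUMMIT.md`; Koch–Nadirashvili–Seregin–Šverák 2009, §5–6 for the
context; the no-swirl case is the accepted theorem `NS.axisymmetric_no_swirl_global_regularity`,
ns.S24). Take `ν > 0`. For every smooth, divergence-free, rapidly decaying (Fefferman's (4)),
axisymmetric datum `u₀ : ℝ³ → ℝ³` the Navier–Stokes equations with `f = 0` have a global
classical solution `(u, p)` on `ℝ³ × [0, ∞)` (jointly `C^∞`, part of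
`Fluid.IsClassicalNSSolutionOn (Ici 0)`) with `u(0) = u₀` and bounded energy. **Open** — the
axisymmetric case of Clay (A); `def` only. [folklore] -/
@[conjecture] def AxisymmetricSwirlRegularity : Prop :=
  ∀ ν : ℝ, 0 < ν → ∀ u₀ : ℝ³ → ℝ³, ContDiff ℝ ∞ u₀ → VectorCalculus.IsDivFree u₀ →
    HasRapidSpatialDecay u₀ → FluidPDE.IsAxisymmetric u₀ →
      ∃ (u : ℝ → ℝ³ → ℝ³) (p : ℝ → ℝ³ → ℝ),
        FluidPDE.IsClassicalNSSolutionOn (Ici 0) ν 0 u p ∧ u 0 = u₀ ∧ HasBoundedEnergy u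

end Summit.NavierStokesRegularity.NavierStokesRegularity
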